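import Mathlib
import Summits.Ventures.PercRepro2.UniversalAlignedSP
import Summits.Ventures.PercRepro2.UniversalAlignedPattern

/-! # (UH*) in counting form
(seat mine-b, cell pub-perc-repro2; MINE-B.md §29, §30)

The universal level-conditioned Hall statement `Universal r b` (UniversalClosures.lean) is an injective
assignment of the slots `(x, i < b x)` of the sources `x` (`r x = 0`, `b x ≥ 1`) to targets `y ≤ x` with
`r y = 1` and `b y + 1 ≥ b x`.  Its counting shadow, for every level `k`: the slots of the sources of blue
level `≥ k` number `Σ_{r x = 0, b x ≥ k} b x`, and they are sent injectively into `{y : r y = 1, b y + 1 ≥ k}`,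
so

  `Σ_{x : r x = 0 ∧ k ≤ b x} b x ≤ #{y : r y = 1 ∧ k ≤ b y + 1}`   for every `k ≥ 1`

(one assignment for all `k`).  Instances: every series–parallel term of the cell's grammar
(`SP.universal_all`, UniversalAlignedSP.lean) and every series–parallel pattern at graph level
(`IsSP.universal`, UniversalAlignedPattern.lean).  At `k = 1`: the number of configurations with red flow
exactly `1` is at least the total blue flow of the configurations with red flow `0`. -/

namespace Summit.Ventures.PercRepro2.UHClosure

open Finset

variable {X : Type*} [Preorder X] [Fintype X] [DecidableEq X]

omit [Preorder X] in
/-- the slots over a fixed source `x` of level `≥ k` are exactly `b x` of them -/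
lemma card_slotsGe_fibre (r b : X → ℕ) (k : ℕ) (x : X) (hx : USrc r b x) :
    ((univ.filter (fun p : SlotL (USrc r b) b => k ≤ b p.1.1.1)).filter (fun p => p.1.1.1 = x)).card
      = if k ≤ b x then b x else 0 := by
  split_ifs with hk
  · rw [← Finset.card_range (b x)]
    refine Finset.card_bij (fun p _ => p.1.2.val) ?_ ?_ ?_
    · intro p hp
      simp only [mem_filter, mem_univ, true_and] at hp
      simp only [mem_range]
      rw [← hp.2]; exact p.2
    · intro p₁ hp₁ p₂ hp₂ h
      simp only [mem_filter, mem_univ, true_and] at hp₁ hp₂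
      apply Subtype.ext; apply Prod.ext
      · apply Subtype.ext; rw [hp₁.2, hp₂.2]
      · exact Fin.ext h
    · intro j hj
      simp only [mem_range] at hj
      refine ⟨⟨(⟨x, hx, hx.2⟩, ⟨j, lt_trans hj (lt_boundL b x)⟩), hj⟩, ?_, rfl⟩
      simp [hk]
  · apply Finset.card_eq_zero.mpr
    apply Finset.filter_eq_empty_iff.mpr
    intro p hp
    simp only [mem_filter, mem_univ, true_and] at hp
    intro h; rw [h] at hp; exact hk hp

omit [Preorder X] in
/-- the number of slots of level `≥ k` is the total blue level of the sources of level `≥ k` -/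
theorem card_slotsGe (r b : X → ℕ) (k : ℕ) :
    (univ.filter (fun p : SlotL (USrc r b) b => k ≤ b p.1.1.1)).card
      = ∑ x ∈ univ.filter (fun x => USrc r b x ∧ k ≤ b x), b x := by
  rw [Finset.card_eq_sum_card_fiberwise (f := fun p => p.1.1.1)
    (t := univ.filter (fun x => USrc r b x ∧ k ≤ b x))]
  · apply Finset.sum_congr rfl
    intro x hx
    simp only [mem_filter, mem_univ, true_and] at hx
    rw [card_slotsGe_fibre r b k x hx.1, if_pos hx.2]
  · intro p hp
    have hp' : k ≤ b p.1.1.1 := by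
      have := hp; simp only [Finset.mem_coe, mem_filter, mem_univ, true_and] at this; exact this
    show p.1.1.1 ∈ (↑(univ.filter (fun x => USrc r b x ∧ k ≤ b x)) : Set X)
    rw [Finset.mem_coe, mem_filter]
    exact ⟨mem_univ _, p.1.1.2.1, hp'⟩

omit [DecidableEq X] in
/-- **(UH*) in counting form**: the slots of level `≥ k` go injectively into the targets of red level `1`
and blue level `≥ k − 1` -/
theorem Universal.card_slotsGe_le {r b : X → ℕ} (h : Universal r b) (k : ℕ) :
    (univ.filter (fun p : SlotL (USrc r b) b => k ≤ b p.1.1.1)).card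
      ≤ (univ.filter (fun y => r y = 1 ∧ k ≤ b y + 1)).card := by
  obtain ⟨f, hf, hspec⟩ := h
  apply Finset.card_le_card_of_injOn f
  · intro p hp
    have hp' : k ≤ b p.1.1.1 := by
      have := hp; simp only [Finset.mem_coe, mem_filter, mem_univ, true_and] at this; exact this
    rw [Finset.mem_coe, mem_filter]
    exact ⟨mem_univ _, (hspec p).2.1, le_trans hp' (hspec p).2.2⟩
  · intro p _ q _ hpq
    exact hf hpq

/-- **(UH*) in counting form, as a sum**: for every `k`,
`Σ_{r x = 0, 1 ≤ b x, k ≤ b x} b x ≤ #{y : r y = 1 ∧ k ≤ b y + 1}` -/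
theorem Universal.sum_le {r b : X → ℕ} (h : Universal r b) (k : ℕ) :
    ∑ x ∈ univ.filter (fun x => USrc r b x ∧ k ≤ b x), b x
      ≤ (univ.filter (fun y => r y = 1 ∧ k ≤ b y + 1)).card := by
  rw [← card_slotsGe]; exact h.card_slotsGe_le k

/-- the same with the source condition written out, for `k ≥ 1` (then `k ≤ b x` gives `1 ≤ b x`) -/
theorem Universal.sum_le' {r b : X → ℕ} (h : Universal r b) {k : ℕ} (hk : 1 ≤ k) :
    ∑ x ∈ univ.filter (fun x => r x = 0 ∧ k ≤ b x), b x
      ≤ (univ.filter (fun y => r y = 1 ∧ k ≤ b y + 1)).card := by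
  have := h.sum_le k
  have hfilt : (univ.filter (fun x => USrc r b x ∧ k ≤ b x)) = univ.filter (fun x => r x = 0 ∧ k ≤ b x) := by
    ext x
    simp only [mem_filter, mem_univ, true_and, USrc]
    constructor
    · rintro ⟨⟨h0, _⟩, hkx⟩; exact ⟨h0, hkx⟩
    · rintro ⟨h0, hkx⟩; exact ⟨⟨h0, le_trans hk hkx⟩, hkx⟩
  rwa [hfilt] at this

/-- at `k = 1`: the number of configurations of red level exactly `1` is at least the total blue level
of the configurations of red level `0` -/
theorem Universal.sum_le_one {r b : X → ℕ} (h : Universal r b) :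
    ∑ x ∈ univ.filter (fun x => r x = 0), b x ≤ (univ.filter (fun y => r y = 1)).card := by
  have := h.sum_le' (k := 1) le_rfl
  have h1 : (univ.filter (fun y => r y = 1 ∧ 1 ≤ b y + 1)) = univ.filter (fun y => r y = 1) := by
    ext y; simp
  have h2 : ∑ x ∈ univ.filter (fun x => r x = 0 ∧ 1 ≤ b x), b x = ∑ x ∈ univ.filter (fun x => r x = 0), b x := by
    rw [Finset.sum_filter, Finset.sum_filter]
    apply Finset.sum_congr rfl
    intro x _
    by_cases h0 : r x = 0
    · by_cases hb : 1 ≤ b x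
      · simp [h0, hb]
      · have : b x = 0 := by omega
        simp [h0, this]
    · simp [h0]
  rwa [h1, h2] at this

end Summit.Ventures.PercRepro2.UHClosure

namespace Summit.Ventures.PercRepro2.V2Closure

open Finset Summit.Ventures.PercRepro2.UHClosure

/-- **(UH*) in counting form on every series–parallel term**: for every `k ≥ 1`,
`Σ_{r x = 0, k ≤ b x} b x ≤ #{y : r y = 1, k ≤ b y + 1}` over the configurations of the term -/
theorem SP.sum_le (s : SP) {k : ℕ} (hk : 1 ≤ k) :
    ∑ x ∈ univ.filter (fun x => s.rLab x = 0 ∧ k ≤ s.bLab x), s.bLab x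
      ≤ (univ.filter (fun y => s.rLab y = 1 ∧ k ≤ s.bLab y + 1)).card :=
  (SP.universal_all s).sum_le' hk

/-- on every series–parallel term the configurations of red flow exactly `1` are at least as many as
the total blue flow of the configurations of red flow `0` -/
theorem SP.sum_le_one (s : SP) :
    ∑ x ∈ univ.filter (fun x => s.rLab x = 0), s.bLab x ≤ (univ.filter (fun y => s.rLab y = 1)).card :=
  (SP.universal_all s).sum_le_one

variable {V : Type*} {E : Type*} [DecidableEq E] [DecidableEq V] [Fintype E]

/-- **(UH*) in counting form on every series–parallel pattern, at graph level**: for every `k ≥ 1`, the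
total blue flow of the configurations with red flow `0` and blue flow `≥ k` is at most the number of
configurations with red flow exactly `1` and blue flow `≥ k − 1` -/
theorem IsSP.sum_le {ends : E → Sym2 V} {s t : V} {O Y : Finset E} (h : IsSP ends s t O Y) {k : ℕ}
    (hk : 1 ≤ k) :
    ∑ x ∈ univ.filter (fun x : Conf Y => rLabP ends s t O Y x = 0 ∧ k ≤ bLabP ends s t O Y x),
        bLabP ends s t O Y x
      ≤ (univ.filter (fun y : Conf Y => rLabP ends s t O Y y = 1 ∧ k ≤ bLabP ends s t O Y y + 1)).card :=
  h.universal.sum_le' hk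

/-- on every series–parallel pattern the configurations of red flow exactly `1` are at least as many as
the total blue flow of the configurations of red flow `0` -/
theorem IsSP.sum_le_one {ends : E → Sym2 V} {s t : V} {O Y : Finset E} (h : IsSP ends s t O Y) :
    ∑ x ∈ univ.filter (fun x : Conf Y => rLabP ends s t O Y x = 0), bLabP ends s t O Y x
      ≤ (univ.filter (fun y : Conf Y => rLabP ends s t O Y y = 1)).card :=
  h.universal.sum_le_one

end Summit.Ventures.PercRepro2.V2Closure
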